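import Summits.BirchSwinnertonDyer.BirchSwinnertonDyer.Theorems.SignedLowerHalvesSmallImageLowerHalfBothSignsRttE2NumAssembly
import HarnessLib

/-!
# Route `SignedLowerHalves`, crux L `SmallImageLowerHalfBothSigns` (item stmt-BirchSwinnertonDyer-23599), line `rtt_w3` —
# row **E2-num** of `Lines/rtt_w3-BRIEF-E2-g8.md` §2, part 5 (HEADLINE, the LEAD's requested shape): in the crux's own
# currency `lambdaInvariant p` — `λ(Λ_𝒪/(f)) = [E:ℚ_p]·(d + Σ_v p^{v_p(f_v)}·layerLambda(P_v.comp (C u_v * (X + 1))))`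
# for `f ∈ Λ_𝒪` with `f^{ℚ̄_p} = c·L·∏_v P_v(u_v(1+T)^{f_v})`, the `Λ = ℤ_p⟦T⟧`-MODULE STRUCTURE on `Λ_𝒪/(f)` being
# RESTRICTION OF SCALARS ALONG `ℤ_p⟦T⟧ → 𝒪⟦T⟧` (coefficientwise `ℤ_p → 𝒪`, `T ↦ T`), stated explicitly

Width seat `bsd-line-slh-p3-w3` g19 under LEAD `cruxlead-stmt-BirchSwinnertonDyer-23599` g8 (cell `bsd-ssimc`); ROUTE-INDEPENDENT
helper (`--supports stmt-BirchSwinnertonDyer-23599`); THEOREMS ONLY — no definition, no named fact, no instance, no `sorry`;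
pure algebra; nothing about any Selmer group, zeta element, Coleman map or modular form is asserted; closes nothing; BSD is
not proved by any of this.

WHY (LEAD g8, bus 13:04:31Z): «target statement = HELPER v13 row E2-num verbatim (LHS in the stub's binders, RHS `lambdaInvariant p`
of `Λ_𝒪 ⧸ span{c·L·∏𝒫_v}` viewed as a Λ-module — state the Λ-module structure you use explicitly (restriction along
ℤ_p⟦T⟧ → 𝒪⟦T⟧) so E2-PT can match it)». Part 4 (`…RttE2NumAssembly`) gave `dim_{ℚ_p}(ℚ_p ⊗_{ℤ_p} Λ_𝒪/(f)) = [E:ℚ_p]·D`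
for the CANONICAL `ℤ_p`-structure of `𝒪_E⟦T⟧/(f)` (`𝒪_E = unitBall p E`); the tree's `lambdaInvariant p M` is
`dim_{ℚ_p}(ℚ_p ⊗_{ℤ_p} M|_{ℤ_p})` for a `Λ`-module `M`, the `ℤ_p`-structure being restriction along `ℤ_p → Λ` (constants).
This file bridges the two and states the headline twice:

* `lambdaInvariant_eq_finrank_baseChange_of_C_smul` — for any `M` carrying a `Λ`-structure and a `ℤ_p`-structure with
  `(C r)•m = r•m`: `lambdaInvariant p M = dim_{ℚ_p}(ℚ_p ⊗_{ℤ_p} M)`.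
* **`lambdaInvariant_quotient_span_eq_of_map_eq_eulerProduct`** (`𝒪 = unitBall p E`, `E/ℚ_p` finite): with the `Λ`-structure on
  `𝒪⟦T⟧/(f)` through Mathlib's `PowerSeries.algebraPowerSeries : Algebra ℤ_p⟦T⟧ 𝒪⟦T⟧` (`= (map (algebraMap ℤ_p 𝒪)).toAlgebra`,
  i.e. RESTRICTION ALONG the coefficientwise map `ℤ_p⟦T⟧ → 𝒪⟦T⟧`) and `Ideal.Quotient.algebra`:
  `lambdaInvariant p (𝒪⟦T⟧/(f)) = [E:ℚ_p]·D`, `D = d + Σ_{v∈s} p^{v_p(f_v)}·layerLambda(P_v.comp (C u_v * (X + 1)))`, under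
  `hf : f^{ℚ̄_p} = C c · L · ∏_{v∈s} P_v(u_v·(1+T)^{f_v})` (`c ≠ 0`; `L ≠ 0` with the stub's two clauses at `d`; `P_v ≠ 0`, `u_v ≠ 0`,
  `f_v ≠ 0`).
* **`lambdaInvariant_quotient_span_eq_of_eulerProduct_iwasawaAlgebraO`** — the same on the crux's carriers `𝒪 = padicCoeffIntegers S`,
  `Λ_𝒪 = IwasawaAlgebraO S` (`[ℚ_p(S):ℚ_p] < ∞`), hypothesis on `iwasawaOToPowerSeries S f`, for ANY ring map
  `ι₀ : ℤ_p → 𝒪` compatible with the inclusions into `ℚ̄_p` (e.g. `ι₀ = padicIntToCoeffIntegers S`, so that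
  `PowerSeries.map ι₀ = iwasawaToIwasawaO S`; by `coe_padicIntToCoeffIntegers`), the `Λ`-structure on `Λ_𝒪/(f)` being the
  EXPLICIT `Module.compHom _ ((Ideal.Quotient.mk _).comp (PowerSeries.map ι₀))` — restriction of scalars along
  `Λ → Λ_𝒪 → Λ_𝒪/(f)`: `lambdaInvariant p (Λ_𝒪/(f)) = [ℚ_p(S):ℚ_p]·D`. This is the LEFT-hand side
  `Module.finrank ℚ_[p] (padicCoeffField S) * (d + Σ …)` of the E2-tail of `stub_charRoad_ns` as a λ-invariant.

References: [Washington1997] §7.1 Thm. 7.3, §13.2; [GreenbergVatsal2000] §2 Prop. (2.4), Cor. (2.3).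
-/

set_option autoImplicit false
-- the Theorems namespace of this sub repeats the summit name by design (D-0017 nested layout)
set_option linter.dupNamespace false

noncomputable section

open scoped TensorProduct

open PowerSeries Literature.NumberTheory.IwasawaTheory Literature.NumberTheory.Automorphic
  Literature.NumberTheory.EllipticCurves

namespace Summit.BirchSwinnertonDyer.BirchSwinnertonDyer.Theorems.SmallImageRttE2Num

universe w

/-! ## §1. `lambdaInvariant` versus `dim_{ℚ_p}(ℚ_p ⊗_{ℤ_p} ·)` for a compatible pair of structures -/

/-- **`lambdaInvariant p M = dim_{ℚ_p}(ℚ_p ⊗_{ℤ_p} M)`** whenever the given `ℤ_p`-structure of the `Λ`-module `M` is the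
restriction along the constants `ℤ_p → Λ = ℤ_p⟦T⟧` (`(C r)•m = r•m`): the tree's `lambdaInvariant` is by definition that
dimension for `RestrictScalars ℤ_p Λ M`, and the identity is then `ℤ_p`-linear. [cite: Washington1997, §13.2] -/
theorem lambdaInvariant_eq_finrank_baseChange_of_C_smul {p : ℕ} [Fact p.Prime] (M : Type w) [AddCommGroup M]
    [Module (IwasawaAlgebra p) M] [Module ℤ_[p] M]
    (hC : ∀ (r : ℤ_[p]) (m : M), (PowerSeries.C r : IwasawaAlgebra p) • m = r • m) :
    lambdaInvariant p M = Module.finrank ℚ_[p] (ℚ_[p] ⊗[ℤ_[p]] M) := by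
  unfold lambdaInvariant
  let e : RestrictScalars ℤ_[p] (IwasawaAlgebra p) M ≃ₗ[ℤ_[p]] M :=
    { RestrictScalars.addEquiv ℤ_[p] (IwasawaAlgebra p) M with
      map_smul' := fun r x ↦ by
        change RestrictScalars.addEquiv ℤ_[p] (IwasawaAlgebra p) M (r • x) = r • RestrictScalars.addEquiv ℤ_[p] (IwasawaAlgebra p) M x
        rw [RestrictScalars.addEquiv_map_smul]
        exact hC r _ }
  exact (e.baseChange ℤ_[p] ℚ_[p] _ _).finrank_eq

/-! ## §2. The headline on `𝒪_E⟦T⟧/(f)` with Mathlib's restriction-of-scalars structure -/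

section UnitBall

variable (p : ℕ) [Fact p.Prime] (E : IntermediateField ℚ_[p] (PadicAlgCl p)) [FiniteDimensional ℚ_[p] E]

omit [FiniteDimensional ℚ_[p] E] in
/-- On `𝒪_E⟦T⟧/(f)` the `Λ`-structure through `PowerSeries.algebraPowerSeries` (restriction along `map (algebraMap ℤ_p 𝒪_E) :
ℤ_p⟦T⟧ → 𝒪_E⟦T⟧`) and the canonical `ℤ_p`-structure satisfy `(C r)•m = r•m`. [folklore] -/
theorem C_smul_quotient_powerSeries_unitBall (f : PowerSeries (PadicIntermediateField.unitBall p E)) (r : ℤ_[p])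
    (m : PowerSeries (PadicIntermediateField.unitBall p E) ⧸ Ideal.span {f}) :
    (PowerSeries.C r : IwasawaAlgebra p) • m = r • m := by
  obtain ⟨y, rfl⟩ := Ideal.Quotient.mk_surjective m
  change Ideal.Quotient.mk (Ideal.span {f}) ((PowerSeries.C r : IwasawaAlgebra p) • y) =
    Ideal.Quotient.mk (Ideal.span {f}) (r • y)
  rw [← IsScalarTower.algebraMap_smul (PowerSeries (PadicIntermediateField.unitBall p E)) (PowerSeries.C r : IwasawaAlgebra p) y,
    ← IsScalarTower.algebraMap_smul (PowerSeries (PadicIntermediateField.unitBall p E)) r y, smul_eq_mul, smul_eq_mul,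
    PowerSeries.algebraMap_apply'', PowerSeries.map_C, PowerSeries.algebraMap_apply]

/-- **E2-num, headline (`𝒪 = 𝒪_E`).** With the `Λ = ℤ_p⟦T⟧`-module structure on `𝒪_E⟦T⟧/(f)` obtained by RESTRICTION OF
SCALARS along the coefficientwise map `ℤ_p⟦T⟧ → 𝒪_E⟦T⟧` (Mathlib's `PowerSeries.algebraPowerSeries`, then
`Ideal.Quotient.algebra`): if `f^{ℚ̄_p} = C c · L · ∏_{v∈s} P_v(u_v·(1+T)^{f_v})` (`c ≠ 0`; `L ≠ 0` attaining its maximal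
coefficient norm first at `d`; `P_v ≠ 0`, `u_v ≠ 0`, `f_v ∈ ℤ_p ∖ 0`), then
`lambdaInvariant p (𝒪_E⟦T⟧/(f)) = [E:ℚ_p]·(d + Σ_{v∈s} p^{v_p(f_v)}·layerLambda(P_v.comp (C u_v * (X + 1))))`.
[cite: Washington1997, §7.1 Thm. 7.3 and §13.2] [cite: GreenbergVatsal2000, §2 Prop. (2.4) and Cor. (2.3)] -/
theorem lambdaInvariant_quotient_span_eq_of_map_eq_eulerProduct {ι : Type*} (s : Finset ι)
    (f : PowerSeries (PadicIntermediateField.unitBall p E)) {c : PadicAlgCl p} (hc : c ≠ 0)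
    {L : PowerSeries (PadicAlgCl p)} (hL : L ≠ 0) {d : ℕ}
    (hle : ∀ k, ‖coeff k L‖ ≤ ‖coeff d L‖) (hlt : ∀ k, k < d → ‖coeff k L‖ < ‖coeff d L‖)
    (P : ι → Polynomial (PadicAlgCl p)) (u : ι → PadicAlgCl p) (fv : ι → ℤ_[p])
    (hP : ∀ v ∈ s, P v ≠ 0) (hu : ∀ v ∈ s, u v ≠ 0) (hfv : ∀ v ∈ s, fv v ≠ 0)
    (hf : f.map (PadicIntermediateField.unitBall p E).subtype = C c * L *
      ∏ v ∈ s, Polynomial.aeval (C (u v) * (binomialSeries ℤ_[p] (fv v)).map (algebraMap ℤ_[p] (PadicAlgCl p))) (P v)) :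
    lambdaInvariant p (PowerSeries (PadicIntermediateField.unitBall p E) ⧸ Ideal.span {f}) =
      Module.finrank ℚ_[p] E *
        (d + ∑ v ∈ s, p ^ (fv v).valuation * layerLambda ((P v).comp (Polynomial.C (u v) * (Polynomial.X + 1)))) := by
  rw [lambdaInvariant_eq_finrank_baseChange_of_C_smul _ (C_smul_quotient_powerSeries_unitBall p E f)]
  exact (finrank_quotient_span_eq_of_map_eq_eulerProduct p E s f hc hL hle hlt P u fv hP hu hfv hf).2.2

end UnitBall

/-! ## §3. The headline on the crux's carriers `padicCoeffIntegers S` / `IwasawaAlgebraO S` -/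

section CruxCurrency

variable (p : ℕ) [Fact p.Prime] (S : Set (PadicAlgCl p)) [FiniteDimensional ℚ_[p] (padicCoeffField S)]

/-- **E2-num, headline on the crux's carriers.** For `𝒪 = padicCoeffIntegers S` (`[ℚ_p(S):ℚ_p] < ∞`), `Λ_𝒪 = IwasawaAlgebraO S`,
ANY ring map `ι₀ : ℤ_p → 𝒪` compatible with the inclusions into `ℚ̄_p` (e.g. `padicIntToCoeffIntegers S`, for which
`PowerSeries.map ι₀ = iwasawaToIwasawaO S`), and `f ∈ Λ_𝒪` with
`iwasawaOToPowerSeries S f = C c · L · ∏_{v∈s} P_v(u_v·(1+T)^{f_v})` (data as in the `𝒪_E` headline): the λ-invariant of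
`Λ_𝒪/(f)` for the `Λ`-module structure `Module.compHom _ ((Ideal.Quotient.mk _).comp (PowerSeries.map ι₀))` — restriction of
scalars along `Λ → Λ_𝒪 → Λ_𝒪/(f)` — is `[ℚ_p(S):ℚ_p]·(d + Σ_{v∈s} p^{v_p(f_v)}·layerLambda(P_v.comp (C u_v * (X + 1))))`, the
left-hand side of the E2-tail of `stub_charRoad_ns` (there `u_v = ℓ_v⁻¹`, `f_v = frobeniusExponent p ℓ_v`, `P_v = P_{g,ℓ_v}`).
[cite: Washington1997, §7.1 Thm. 7.3 and §13.2] [cite: GreenbergVatsal2000, §2 Prop. (2.4) and Cor. (2.3)] -/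
theorem lambdaInvariant_quotient_span_eq_of_eulerProduct_iwasawaAlgebraO {ι : Type*} (s : Finset ι)
    {c : PadicAlgCl p} (hc : c ≠ 0) {L : PowerSeries (PadicAlgCl p)} (hL : L ≠ 0) {d : ℕ}
    (hle : ∀ k, ‖coeff k L‖ ≤ ‖coeff d L‖) (hlt : ∀ k, k < d → ‖coeff k L‖ < ‖coeff d L‖)
    (P : ι → Polynomial (PadicAlgCl p)) (u : ι → PadicAlgCl p) (fv : ι → ℤ_[p])
    (hP : ∀ v ∈ s, P v ≠ 0) (hu : ∀ v ∈ s, u v ≠ 0) (hfv : ∀ v ∈ s, fv v ≠ 0) :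
    ∀ (ι₀ : ℤ_[p] →+* padicCoeffIntegers S),
      (∀ x : ℤ_[p], ((ι₀ x : padicCoeffIntegers S) : PadicAlgCl p) = algebraMap ℚ_[p] (PadicAlgCl p) (x : ℚ_[p])) →
    ∀ f : IwasawaAlgebraO S,
      iwasawaOToPowerSeries S f = C c * L *
        ∏ v ∈ s, Polynomial.aeval (C (u v) * (binomialSeries ℤ_[p] (fv v)).map (algebraMap ℤ_[p] (PadicAlgCl p))) (P v) →
      @lambdaInvariant p _ (IwasawaAlgebraO S ⧸ Ideal.span {f}) _
          (Module.compHom (IwasawaAlgebraO S ⧸ Ideal.span {f})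
            ((Ideal.Quotient.mk (Ideal.span {f})).comp (PowerSeries.map ι₀))) =
        Module.finrank ℚ_[p] (padicCoeffField S) *
          (d + ∑ v ∈ s, p ^ (fv v).valuation * layerLambda ((P v).comp (Polynomial.C (u v) * (Polynomial.X + 1)))) := by
  unfold iwasawaOToPowerSeries IwasawaAlgebraO
  rw [padicCoeffIntegers_eq_unitBall S]
  intro ι₀ hι₀ f hf
  -- `ι₀` is the structure map `ℤ_p → 𝒪_E`, `E = ℚ_p(S)`
  have hι : ι₀ = algebraMap ℤ_[p] (PadicIntermediateField.unitBall p (padicCoeffField S)) := by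
    refine RingHom.ext fun x ↦ Subtype.ext ?_
    rw [hι₀ x]
    change algebraMap ℚ_[p] (PadicAlgCl p) (x : ℚ_[p]) = algebraMap ℤ_[p] (PadicAlgCl p) x
    rw [IsScalarTower.algebraMap_apply ℤ_[p] ℚ_[p] (PadicAlgCl p), PadicInt.algebraMap_apply]
  subst hι
  -- the explicit `compHom` structure satisfies `(C r)•m = r•m`
  have hC : ∀ (r : ℤ_[p]) (m : PowerSeries (PadicIntermediateField.unitBall p (padicCoeffField S)) ⧸ Ideal.span {f}),
      @HSMul.hSMul (IwasawaAlgebra p) _ _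
        (@instHSMul _ _ (Module.compHom (PowerSeries (PadicIntermediateField.unitBall p (padicCoeffField S)) ⧸ Ideal.span {f})
          ((Ideal.Quotient.mk (Ideal.span {f})).comp (PowerSeries.map
            (algebraMap ℤ_[p] (PadicIntermediateField.unitBall p (padicCoeffField S)))))).toSMul)
        (PowerSeries.C r : IwasawaAlgebra p) m = r • m := by
    intro r m
    obtain ⟨y, rfl⟩ := Ideal.Quotient.mk_surjective m
    change Ideal.Quotient.mk (Ideal.span {f}) (PowerSeries.map
        (algebraMap ℤ_[p] (PadicIntermediateField.unitBall p (padicCoeffField S))) (PowerSeries.C r)) *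
      Ideal.Quotient.mk (Ideal.span {f}) y = Ideal.Quotient.mk (Ideal.span {f}) (r • y)
    rw [← map_mul, PowerSeries.map_C,
      ← IsScalarTower.algebraMap_smul (PowerSeries (PadicIntermediateField.unitBall p (padicCoeffField S))) r y,
      smul_eq_mul, PowerSeries.algebraMap_apply]
  rw [@lambdaInvariant_eq_finrank_baseChange_of_C_smul p _ _ _ (Module.compHom _ _) _ hC]
  exact (finrank_quotient_span_eq_of_map_eq_eulerProduct p (padicCoeffField S) s f hc hL hle hlt P u fv hP hu hfv hf).2.2

end CruxCurrency

end Summit.BirchSwinnertonDyer.BirchSwinnertonDyer.Theorems.SmallImageRttE2Num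

end
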